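import Summits.BirchSwinnertonDyer.BirchSwinnertonDyer.Theorems.SignedBaseChangeAnticyclotomicEisensteinDivisibilityAlmostDivisibleAssembly
import Literature.NumberTheory.DiophantineGeometry.LocalReductionFiniteBadPlacesProofs
import HarnessLib

/-!
# Crux `AnticyclotomicEisensteinDivisibility` (stmt-BirchSwinnertonDyer-20727), line `bdpline` v15, stub
# `stub_finiteExponentSS`, Greenberg-2016 road: `X_Gr(E/K̃_∞)` has no non-zero pseudo-null submodule —
# the assembly with the auxiliary set `S`, the model and the topologies CHOSEN, leaving only the line's
# torsion input, the six published facts, and the two instance bricks (helper for stmt-BirchSwinnertonDyer-20727)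

Cell `bsd-ssimc` (hosting route `SignedBaseChange`), width seat `bsd-line-sbc-p1-w2` gen 3; seventh file of
the lane. `SignedBaseChangeAcDivAssembly.xGr₂_hasNoPseudoNullSubmodule_curve` (p627029) still displays the
auxiliary data of Greenberg's arena — a finite `S ⊇ {w ∣ p}` with `N_S` trivial on `E[p^∞]`, the descended
`ρ₀`, and Prop-valued topological instances on `ℤ_p⟦T⟧`, `Λ₂`, `𝐃`. This file CHOOSES them:
`S := {w ∣ p} ∪ {bad places of W}` (finite: `finite_setOf_natCast_mem`, `finite_badPlaces_holds`;
Néron–Ogg–Shafarevich `smul_primaryTorsion_eq_of_mem_ramificationSubgroup`), `ρ₀` from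
`exists_continuousRep_primaryTorsion`, discrete topologies (as bsd-eis `shapiroBridge_of_pureShapiroBridge`).

* `xGr₂_hasNoPseudoNullSubmodule_of_bricks` — for `K` imaginary quadratic, `p > 2` split as `v v̄`, a
  generator pair and an ELLIPTIC `W/K`: every pseudo-null `Λ₂`-submodule of `X_Gr₂ = W.XGr₂ p κ₁ κ₂ v̄ γ₁ γ₂`
  is `⊥`, GRANTED: the six PUBLISHED facts (by name); `Module.IsTorsion Λ₂ X_Gr₂` (the line's
  `stub_torsionSS`); (R1a) `IsCofree ℤ_p (PrimaryTorsion W.geomPoints p)` with a `ℤ_p`-basis of a Tate dual;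
  (R1b) LOC_v⁽¹⁾ / `corank H⁰ = 0` for EVERY admissible `(S, ρ₀)` (universally quantified, any topologies).
* `xGr₂_torsionBy_X_eq_zero_of_bricks` — hence at `(T₁) ∉ Supp X_Gr₂` a power of `p` (namely `p^0`)
  kills `X_Gr₂[T₁]`: the conclusion of `stub_finiteExponentSS` for the curve `W/K`
  (`S2.pow_smul_torsionBy_eq_zero_of_noPseudoNull`).

Theorems only; no definition, no named fact, no `sorry`. HONEST FRAMING: conditional on the displayed
hypotheses; closes nothing by itself (`--supports stmt-BirchSwinnertonDyer-20727`); the telescope to the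
registered binders (`W := W₀.baseChange K`, `2 < p ⟸ 5 ≤ p`, `htors ⟸ stub_torsionSS`) is left to the LEAD's
reshape; no summit statement / BSD is proved by this file.
References: [Greenberg2016Selmer] Prop. 4.1.1 (c) p. 15, §4.3 pp. 20–21; [Greenberg2006] Thm. 3, Props.
3.2/4.1/4.2, §5 A; [SilvermanAEC2009] VII.4.1, VIII.1 Rem. 1.3; [BurungaleCastellaSkinner2025] §2.1 p. 6.
-/

-- `Summit.BirchSwinnertonDyer.BirchSwinnertonDyer.…`: summit and sub-problem share a name (D-0017 layout).
set_option linter.dupNamespace false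
set_option autoImplicit false

noncomputable section

open scoped Classical
open NumberField IsDedekindDomain Field
open Literature.NumberTheory.EllipticCurves Literature.NumberTheory.GaloisRepresentations
  Literature.NumberTheory.EllipticCurves.Rubin1991
  Literature.NumberTheory.IwasawaTheory Literature.NumberTheory.IwasawaTheory.Greenberg2006
  Literature.NumberTheory.IwasawaTheory.Greenberg2016
  Summit.BirchSwinnertonDyer.BirchSwinnertonDyer.Theorems.SignedBaseChangeAcDivFiniteExponent
  Summit.BirchSwinnertonDyer.BirchSwinnertonDyer.Theorems.SignedBaseChangeAcDivCurveModel
  Summit.BirchSwinnertonDyer.BirchSwinnertonDyer.Theorems.SignedBaseChangeAcDivAssembly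

namespace Summit.BirchSwinnertonDyer.BirchSwinnertonDyer.Theorems.SignedBaseChangeAcDivNoPseudoNull

variable {K : Type} [Field K] [NumberField K] {p : ℕ} [Fact p.Prime] (W : WeierstrassCurve K)
  [W.IsElliptic] (κ₁ κ₂ : ZpExtension K p) (vbar : HeightOneSpectrum (𝓞 K)) (γ₁ γ₂ : absoluteGaloisGroup K)
  [hγ : Fact (ZpExtension.IsTopGeneratorPair κ₁ κ₂ γ₁ γ₂)]

/-- **`X_Gr(E/K̃_∞)` has no non-zero pseudo-null `Λ₂`-submodule**, for an elliptic `W/K` over an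
imaginary quadratic `K` with `p > 2` split as `v v̄` and a generator pair, GRANTED the six PUBLISHED facts,
`Λ₂`-torsion of `X_Gr₂`, (R1a) cofreeness of `E[p^∞]` with a Tate-dual basis and (R1b) LOC_v⁽¹⁾ /
`corank H⁰ = 0` for every admissible `(S, ρ₀)`. The arena (`S = {w ∣ p} ∪` bad places, the descended `ρ₀`,
discrete topologies) is chosen inside. [cite: Greenberg2016Selmer, Prop. 4.1.1 (c) p. 15, §4.3 pp. 20–21]
[cite: Greenberg2006, Thm. 3 p. 342] [cite: SilvermanAEC2009, VIII.1 Rem. 1.3] -/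
theorem xGr₂_hasNoPseudoNullSubmodule_of_bricks
    (h411 : prop411_selmer_isAlmostDivisible) (h422 : prop422_localCohomology_isAlmostDivisible)
    (h5A : sec5A_localH2_subsingleton_of_LOC1) (h41 : prop41_globalEulerPoincareCorank)
    (h42 : prop42_localEulerPoincareCorank) (h32 : prop32_cohomology_isCofinitelyGenerated)
    (hp : 2 < p) (hK : IsImaginaryQuadratic K)
    {v : HeightOneSpectrum (𝓞 K)} (hv : ((p : ℕ) : 𝓞 K) ∈ v.asIdeal)
    (hvbar : ((p : ℕ) : 𝓞 K) ∈ vbar.asIdeal) (hne : vbar ≠ v)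
    (htors : Module.IsTorsion (IwasawaAlgebra₂ p) (W.XGr₂ p κ₁ κ₂ vbar γ₁ γ₂))
    (hcofree : IsCofree ℤ_[p] (PrimaryTorsion W.geomPoints p))
    (hTate : ∃ (Y : Type) (_ : AddCommGroup Y) (_ : Module ℤ_[p] Y)
      (tA : Y →+ (PrimaryTorsion W.geomPoints p →+ DiscreteGaloisModule.UnitsCarrier K))
      (_ : IsDualPairing ℤ_[p] (PrimaryTorsion W.geomPoints p) tA) (n : ℕ),
      Nonempty (Module.Basis (Fin n) ℤ_[p] Y))
    (hR1b : ∀ [TopologicalSpace (PowerSeries ℤ_[p])] [TopologicalSpace (PowerSeries (PowerSeries ℤ_[p]))]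
      [IsTopologicalRing (PowerSeries (PowerSeries ℤ_[p]))]
      [IsTopologicalAddGroup (IndModule₂ ℤ_[p] p (PrimaryTorsion W.geomPoints p))]
      [ContinuousSMul (PowerSeries (PowerSeries ℤ_[p])) (IndModule₂ ℤ_[p] p (PrimaryTorsion W.geomPoints p))]
      (S : Set (HeightOneSpectrum (𝓞 K)))
      (hS : ∀ w : HeightOneSpectrum (𝓞 K), ((p : ℕ) : 𝓞 K) ∈ w.asIdeal → w ∈ S)
      (ρ₀ : ContinuousRep (GaloisGroupUnramifiedOutside K S) ℤ_[p] (PrimaryTorsion W.geomPoints p)),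
      (∀ (σ : absoluteGaloisGroup K) (P : PrimaryTorsion W.geomPoints p), ρ₀ (toUnramifiedQuot K S σ) P = σ • P) →
      (∀ w : HeightOneSpectrum (𝓞 K), w ∈ S → LOC1 S (twistDeformation S hS κ₁ κ₂ ρ₀) (Sum.inr w)) ∧
      (∀ w : HeightOneSpectrum (𝓞 K), w ∈ S →
        HasCorank (IwasawaAlgebra₂ p) ((localRep S (twistDeformation S hS κ₁ κ₂ ρ₀) (Sum.inr w)).H 0) 0) ∧
      HasCorank (IwasawaAlgebra₂ p) ((twistDeformation S hS κ₁ κ₂ ρ₀).H 0) 0) :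
    HasNoPseudoNullSubmodule (IwasawaAlgebra₂ p) (W.XGr₂ p κ₁ κ₂ vbar γ₁ γ₂) := by
  -- the arena: `S = {w ∣ p} ∪ {bad places}`
  set S : Set (HeightOneSpectrum (𝓞 K)) :=
    {w | ((p : ℕ) : 𝓞 K) ∈ w.asIdeal} ∪ W.badPlaces (𝓞 K) with hSdef
  have hSf : S.Finite :=
    (HeightOneSpectrum.finite_setOf_natCast_mem (Fact.out : p.Prime).ne_zero).union
      (W.finite_badPlaces_holds (𝓞 K))
  have hS : ∀ w : HeightOneSpectrum (𝓞 K), ((p : ℕ) : 𝓞 K) ∈ w.asIdeal → w ∈ S := fun w hw ↦ Or.inl hw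
  have hSbad : ∀ w : HeightOneSpectrum (𝓞 K), ¬ W.HasGoodReductionAt w → w ∈ S := fun w hw ↦ Or.inr hw
  have hNS : ∀ n ∈ ramificationSubgroup K S, ∀ P : PrimaryTorsion W.geomPoints p, n • P = P :=
    fun n hn P ↦ smul_primaryTorsion_eq_of_mem_ramificationSubgroup W p S hSbad hS hn P
  obtain ⟨ρ₀, hρ₀⟩ := exists_continuousRep_primaryTorsion W p S hNS
  -- discrete topologies on `ℤ_p⟦T⟧`, `Λ₂`, hence on `𝐃`
  letI tΛ₁ : TopologicalSpace (PowerSeries ℤ_[p]) := ⊥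
  letI tΛ₂ : TopologicalSpace (PowerSeries (PowerSeries ℤ_[p])) := ⊥
  haveI : DiscreteTopology (PowerSeries (PowerSeries ℤ_[p])) := ⟨rfl⟩
  haveI hΛring : IsTopologicalRing (PowerSeries (PowerSeries ℤ_[p])) := inferInstance
  haveI hDgrp : IsTopologicalAddGroup (IndModule₂ ℤ_[p] p (PrimaryTorsion W.geomPoints p)) := inferInstance
  haveI hDsmul : ContinuousSMul (PowerSeries (PowerSeries ℤ_[p]))
      (IndModule₂ ℤ_[p] p (PrimaryTorsion W.geomPoints p)) := inferInstance
  obtain ⟨hLOC1, h0loc, h0⟩ := hR1b S hS ρ₀ hρ₀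
  exact xGr₂_hasNoPseudoNullSubmodule_curve W hS κ₁ κ₂ ρ₀ vbar γ₁ γ₂ h411 h422 h5A h41 h42 h32 hSf hp hK
    hv hvbar hne hNS hρ₀ htors hcofree hTate hLOC1 h0loc h0

/-- **`X_Gr₂[T₁]` has finite exponent (indeed is `0`) at `(T₁) ∉ Supp X_Gr₂`** — the conclusion of
`stub_finiteExponentSS` for the curve `W/K`, under the hypotheses of
`xGr₂_hasNoPseudoNullSubmodule_of_bricks` (`S2.pow_smul_torsionBy_eq_zero_of_noPseudoNull`).
[cite: Greenberg2016Selmer, Prop. 4.1.1 p. 15, §1 p. 2] [cite: BurungaleCastellaSkinner2025, §2.1 p. 6] -/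
theorem xGr₂_torsionBy_X_finiteExponent_of_bricks
    (h411 : prop411_selmer_isAlmostDivisible) (h422 : prop422_localCohomology_isAlmostDivisible)
    (h5A : sec5A_localH2_subsingleton_of_LOC1) (h41 : prop41_globalEulerPoincareCorank)
    (h42 : prop42_localEulerPoincareCorank) (h32 : prop32_cohomology_isCofinitelyGenerated)
    (hp : 2 < p) (hK : IsImaginaryQuadratic K)
    {v : HeightOneSpectrum (𝓞 K)} (hv : ((p : ℕ) : 𝓞 K) ∈ v.asIdeal)
    (hvbar : ((p : ℕ) : 𝓞 K) ∈ vbar.asIdeal) (hne : vbar ≠ v)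
    (htors : Module.IsTorsion (IwasawaAlgebra₂ p) (W.XGr₂ p κ₁ κ₂ vbar γ₁ γ₂))
    (hcofree : IsCofree ℤ_[p] (PrimaryTorsion W.geomPoints p))
    (hTate : ∃ (Y : Type) (_ : AddCommGroup Y) (_ : Module ℤ_[p] Y)
      (tA : Y →+ (PrimaryTorsion W.geomPoints p →+ DiscreteGaloisModule.UnitsCarrier K))
      (_ : IsDualPairing ℤ_[p] (PrimaryTorsion W.geomPoints p) tA) (n : ℕ),
      Nonempty (Module.Basis (Fin n) ℤ_[p] Y))
    (hR1b : ∀ [TopologicalSpace (PowerSeries ℤ_[p])] [TopologicalSpace (PowerSeries (PowerSeries ℤ_[p]))]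
      [IsTopologicalRing (PowerSeries (PowerSeries ℤ_[p]))]
      [IsTopologicalAddGroup (IndModule₂ ℤ_[p] p (PrimaryTorsion W.geomPoints p))]
      [ContinuousSMul (PowerSeries (PowerSeries ℤ_[p])) (IndModule₂ ℤ_[p] p (PrimaryTorsion W.geomPoints p))]
      (S : Set (HeightOneSpectrum (𝓞 K)))
      (hS : ∀ w : HeightOneSpectrum (𝓞 K), ((p : ℕ) : 𝓞 K) ∈ w.asIdeal → w ∈ S)
      (ρ₀ : ContinuousRep (GaloisGroupUnramifiedOutside K S) ℤ_[p] (PrimaryTorsion W.geomPoints p)),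
      (∀ (σ : absoluteGaloisGroup K) (P : PrimaryTorsion W.geomPoints p), ρ₀ (toUnramifiedQuot K S σ) P = σ • P) →
      (∀ w : HeightOneSpectrum (𝓞 K), w ∈ S → LOC1 S (twistDeformation S hS κ₁ κ₂ ρ₀) (Sum.inr w)) ∧
      (∀ w : HeightOneSpectrum (𝓞 K), w ∈ S →
        HasCorank (IwasawaAlgebra₂ p) ((localRep S (twistDeformation S hS κ₁ κ₂ ρ₀) (Sum.inr w)).H 0) 0) ∧
      HasCorank (IwasawaAlgebra₂ p) ((twistDeformation S hS κ₁ κ₂ ρ₀).H 0) 0)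
    (h0 : Literature.NumberTheory.EllipticCurves.Module.lengthAt (IwasawaAlgebra₂ p) (W.XGr₂ p κ₁ κ₂ vbar γ₁ γ₂)
      ⟨Ideal.span {(PowerSeries.X : IwasawaAlgebra₂ p)}, PowerSeries.span_X_isPrime⟩ = 0) :
    ∃ m : ℕ, ∀ x : W.XGr₂ p κ₁ κ₂ vbar γ₁ γ₂, (PowerSeries.X : IwasawaAlgebra₂ p) • x = 0 →
      ((p : IwasawaAlgebra₂ p) ^ m) • x = 0 :=
  SignedBaseChangeAcDivSpecialization.S2.pow_smul_torsionBy_eq_zero_of_noPseudoNull p _ h0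
    (xGr₂_hasNoPseudoNullSubmodule_of_bricks W κ₁ κ₂ vbar γ₁ γ₂ h411 h422 h5A h41 h42 h32 hp hK hv hvbar
      hne htors hcofree hTate hR1b)

end Summit.BirchSwinnertonDyer.BirchSwinnertonDyer.Theorems.SignedBaseChangeAcDivNoPseudoNull

end
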